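import Summits.BirchSwinnertonDyer.Rank1Residual.X11b.AnticyclotomicSigmaPassage
import Summits.BirchSwinnertonDyer.Rank1Residual.X11b.AnticyclotomicEulerCharLinks
import Summits.BirchSwinnertonDyer.Rank1Residual.X11b.AnticyclotomicLocalTorsionDescent
import Summits.BirchSwinnertonDyer.Rank1Residual.X11b.AnticyclotomicTamagawa
import Summits.BirchSwinnertonDyer.Rank1Residual.X11b.TamagawaLocalLemmas
import Literature.NumberTheory.EllipticCurves.MatsunoCurvesRankProofs
import HarnessLib

/-!
# X11b, route R1 — the control input (CTL) DECOMPOSED: Cas18 Thm. 2.3 at a datum from FOUR verbatim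
# atoms of JSW17 §3 on the constructed objects (three Poitou–Tate atoms, one local Tamagawa atom)

HONEST FRAMING (cell `b2b-bsdres`, run/shared/lean/b2b/bsd-rank1-residual/, verbatim in every
file): the goal of the cell is to DELETE the COMBINATION-SHAPED residual classes of the
Birch–Swinnerton-Dyer formula for ALL analytic-rank `≤ 1` elliptic curves over `ℚ` — "full BSD
formula for every rank `≤ 1` curve in class `C`" assembled STRICTLY from published theorems — so
that the rank-`≤ 1` remainder becomes exactly the CONSTRUCTION-SHAPED classes, which are TYPED
(missing-input `Prop`s), NOT attempted. This is not "finishing BSD". Sub-cell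
`b2b-bsdres-multr1-p1` (X11b, route R1 = Castella 2018 Thm. A re-proved along the author's
erratum); a RESEARCH ROUTE; no claim beyond the stated class; X11b stays CONSTRUCTION-SHAPED;
nothing here changes a label; no named fact is minted (five `Prop`-valued predicates and one `ℕ`
with bodies — typed SHAPES, nothing asserted — and theorems; no `sorry`).

## What this file does

Route R1's statement of record `R1.bsdp_of_onTree` takes Cas18 Thm. 2.3 as ONE typed input
`ControlOnTreeAt` (PUB shape: `X_ac` torsion and `ord_p f_ac(0) = ord_p #Ш(E/K)[p^∞] +
2((ord_p log_ω P − 1) − ord_p[E(K):ℤP]) + ord_p ∏_{w∣N⁺} c_w(E/K)`). Gens 9–11 and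
`AnticyclotomicSigmaPassage` turned its proof (JSW17 §3.3, "following Greenberg") into kernel theorems
up to four published sub-statements, typed here VERBATIM on the constructed objects:

* (P6) `BaseSelmerCountAt` — JSW17 Prop. 3.2.1 with (7.1.5): `#H¹_ac(K, E[p^∞]) = #Ш(E/K)[p^∞] ·
  (#ℤ_p/((#Ẽ/p)·log_ω P) / ([E(K):ℤP]_p · #H⁰(K_v, E[p^∞])))²`, read at a MULTIPLICATIVE `p` (the
  proof's `#Ẽ(𝔽_p)` is `[E(K_v):E₁(K_v)] = c_p·#Ẽ_ns(𝔽_p)`, `#Ẽ_ns(𝔽_p) = p ∓ 1` a `p`-unit, and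
  `Σ_{w∣p} ord_p c_w(E/K) = 2·ord_p c_p(E)` for `p` split) with `H⁰(K_v, E[p^∞]) = 0` (hypothesis (iv)
  of the erratum, in force at every R1 datum): `#Sel_𝔭(K, E[p^∞]) = p^a`,
  `a = ord_p #Ш + 2((ord_p log_ω P − 1) − ord_p idx) + Σ_{w∣p} ord_p c_w(E/K)`. Poitou–Tate.
* (P9) `LocSurjAt` — JSW17 Prop. 3.3.2 (restrict-eq2) ⟹ §3.3.4 "`0 → H¹_ac(K,W) → H¹_{ac^Σ}(K,W) →
  P_ac(W;Σ) → 0`": `loc_Σ : Sel_𝔭^Σ(K, E[p^∞]) → ∏_{w∈Σ} H¹(K_w, E[p^∞])` is ONTO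
  (`H¹_f(K_w, E[p^∞]) = 0` at `w ∤ p`). Poitou–Tate.
* (L10) `CoinvariantsTrivialAt` — JSW17 Lemma 3.3.3: `H¹_{ac}(K, M)_Γ = 0`, i.e. `γ − 1` is onto on
  `Sel_𝔭(K_∞, E[p^∞])`. Poitou–Tate (`Ш²_S(W)` dual to `Ш¹_S(T) = 0`).
* (P11) `LocalKernelOrderAt` — JSW17 Prop. 3.3.4 Case 1(a)/2(a) (= Greenberg LNM 1716 pp. 74–75):
  at a split `w ∤ p`, `#ker(H¹(K_w, E[p^∞]) → H¹(K_{∞,η}, E[p^∞])) = c_w^{(p)}(E/K)`, the `p`-part of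
  the local Tamagawa number. Local (Tate curve; `w` finitely decomposed in `K_∞^{ac}`).

and PROVES the glue: `ErratumHypotheses.controlMap_bijective_nPlus` (gen 11's bijection from the
A′-hypotheses alone), the Tamagawa bookkeeping `ord_p ∏_{w∣N⁺} c_w = Σ_{w∣p} ord_p c_w +
Σ_{w∈Σ(N⁺)} ord_p c_w` (`padicValNat_tamagawaProductSplit_eq_above_add_sum`; Castella's `N⁺`
contains `p`), and **`controlOnTreeAt_of_atoms`: (P6) ∧ (P9) ∧ (L10) ∧ (P11 at every `w ∈ Σ(N⁺)`)
⟹ `ControlOnTreeAt`** at every R1 datum (imaginary quadratic `K` with `p` split, anticyclotomic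
`κ`, topological generator `γ`, degree-one `𝔭`, any `ι`, `P`). Class level: `AnticyclotomicControlFromAtoms`.

References: [JetchevSkinnerWan2017] Camb. J. Math. 5 (2017) §3.2–3.3, §7.1 (arXiv:1512.06894
pp. 10–16); [Castella2018] Thm. 2.3 (arXiv:1704.06608 p. 5); [GreenbergLNM1716] §3 pp. 74–75, 85–90.
-/

noncomputable section

open scoped Classical

open WeierstrassCurve NumberField IsDedekindDomain Field
open Literature.NumberTheory.EllipticCurves Literature.NumberTheory.EllipticCurves.GreenbergSelmer
open Literature.NumberTheory.EllipticCurves.Rank1Residual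
open Literature.NumberTheory.EllipticCurves.Rank1Residual.Typed
open Literature.NumberTheory.GaloisRepresentations
open Summit.BirchSwinnertonDyer.Rank1Residual.X11b.AcSelmer

namespace Summit.BirchSwinnertonDyer.Rank1Residual.X11b

/-! ## The atoms (typed shapes on tree objects; nothing asserted) -/

section Atoms

variable {K : Type} [Field K] [NumberField K]

/-- **`∏_{w ∣ p} c_w(E/K)`** — the local Tamagawa numbers of `E_K = W.baseChange K` at the places of
`K` above `p` (for `p` split: `c_𝔭 c_𝔭̄ = c_p(E)²`); the part of Castella's `∏_{w∣N⁺} c_w` (Cas18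
Thm. 2.3, `p ∣ N⁺`) that JSW17 carry inside `(#δ_v)²`. A definition; nothing asserted.
[cite: Castella2018, Thm. 2.3 (arXiv:1704.06608 p. 5)] [cite: JetchevSkinnerWan2017, §7.1 (7.1.4)–(7.1.5) (arXiv:1512.06894 pp. 15–16)] -/
def tamagawaProductAbove (W : WeierstrassCurve ℚ) (K : Type) [Field K] [NumberField K] (p : ℕ) : ℕ :=
  ∏ᶠ w : HeightOneSpectrum (𝓞 K),
    if ((p : ℕ) : 𝓞 K) ∈ w.asIdeal then
      ((W.baseChange K).baseChange (w.adicCompletion K)).localTamagawaNumber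
        (w.adicCompletionIntegers K)
    else 1

/-- **(P6) JSW17 Prop. 3.2.1 with (7.1.5), at a multiplicative `p`, EVERY SYMBOL A TREE OBJECT — PUB
shape (Poitou–Tate).** "`#H¹_ac(K, W) = #Ш_BK(W/K)·(#δ_v)²`" with "`#δ_v = #ℤ_p/(((1−a_p+p)/p)·log_{ω_E} P)
/ ([E(K):ℤ·P]_p · #H⁰(K_v, E[p^∞]))`" (JSW for good `p`; the proof's `#ℤ_p/(1−a_p+p)` is
`[E(K_v):E₁(K_v)]_p`, at a multiplicative `p` equal to `ord_p c_p` since `#Ẽ_ns(𝔽_p) = p ∓ 1`), read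
with `H⁰(K_v, E[p^∞]) = 0` (erratum hypothesis (iv), in force at every R1 datum) and
`Σ_{w∣p} ord_p c_w(E/K) = 2 ord_p c_p(E)` (`p = 𝔭𝔭̄` split): Castella's Selmer group OVER `K`
(`selmerAcBase`, Cas18 Def. 2.2 at level `K`) is finite of order `p^a`,
`a = ord_p #Ш(E/K)[p^∞] + 2((ord_p log_ω P − 1) − ord_p [E(K):ℤP]) + ord_p ∏_{w∣p} c_w(E/K)`
(`ord_p log_ω P = padicLogOrd W p ι P`, `ι` intended `embAt K p 𝔭`). A predicate; nothing asserted;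
NOT a named fact. [cite: JetchevSkinnerWan2017, Prop. 3.2.1 and (7.1.5) (arXiv:1512.06894 pp. 10–11, 16) (shape only; nothing asserted)]
[cite: Castella2018, Thm. 2.3 (arXiv:1704.06608 p. 5) (shape only; nothing asserted)] -/
def BaseSelmerCountAt {W : WeierstrassCurve ℚ} [W.IsElliptic] [W.IsGloballyMinimal] (p : ℕ)
    [Fact p.Prime] (𝔭 : HeightOneSpectrum (𝓞 K)) (ι : K →+* ℚ_[p])
    (P : (W.baseChange K).toAffine.Point) : Prop :=
  ∃ a : ℕ, (∃ _ : Finite (selmerAcBase (W.baseChange K) p 𝔭 ∅),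
      Nat.card (selmerAcBase (W.baseChange K) p 𝔭 ∅) = p ^ a) ∧
    (a : ℤ) = (padicValNat p (Nat.card (AddCommGroup.primaryComponent (W.baseChange K).sha p)) : ℤ) +
      2 * ((padicLogOrd W p ι P - 1) - (padicValNat p (AddSubgroup.zmultiples P).index : ℤ)) +
        padicValNat p (tamagawaProductAbove W K p)

/-- **(P9) JSW17 Prop. 3.3.2 (restrict-eq2) in the form used in §3.3.4 — PUB shape (Poitou–Tate).**
"there is an exact sequence `0 → H¹_ac(K,W) → H¹_{ac^Σ}(K,W) → P_ac(W;Σ) → 0`", `P_ac(W;Σ) =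
∏_{w∈Σ} H¹(K_w,W)/H¹_ac(K_w,W) = ∏_{w∈Σ} H¹(K_w, W)` (`H¹_f(K_w, W) = 0` at `w ∤ p`, §2.2.2): the
localisation `loc_Σ : Sel_𝔭^Σ(K, E[p^∞]) → ∏_{w∈Σ} H¹(K_w, E[p^∞])` (`AcSelmer.locSel`, `H¹(K_w, ·) =
H¹(D_w, ·)`) is SURJECTIVE. A predicate; nothing asserted; NOT a named fact.
[cite: JetchevSkinnerWan2017, Prop. 3.3.2 and §3.3.4 (arXiv:1512.06894 pp. 11, 13) (shape only; nothing asserted)] -/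
def LocSurjAt (E : WeierstrassCurve K) (p : ℕ) [Fact p.Prime] (𝔭 : HeightOneSpectrum (𝓞 K))
    {S : Set (HeightOneSpectrum (𝓞 K))} (hS : S.Finite) : Prop :=
  Function.Surjective (locSel E p 𝔭 hS)

/-- **(L10) JSW17 Lemma 3.3.3 — PUB shape (Poitou–Tate).** "`H¹_{ac^Σ}(K, M)_Γ = 0`" for `Σ = ∅`:
the `Γ`-coinvariants of `Sel_𝔭(K_∞, E[p^∞])` vanish, i.e. `conj_γ − 1` is ONTO (`K_∞`-formulation;
independent of the topological generator `γ`, `range_conjSelmerAc_sub_one_eq_closure`). A predicate;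
nothing asserted; NOT a named fact. [cite: JetchevSkinnerWan2017, Lemma 3.3.3 (arXiv:1512.06894 pp. 11–12) (shape only; nothing asserted)] -/
def CoinvariantsTrivialAt (E : WeierstrassCurve K) (p : ℕ) [Fact p.Prime] (κ : ZpExtension K p)
    (𝔭 : HeightOneSpectrum (𝓞 K)) (γ : absoluteGaloisGroup K) : Prop :=
  Function.Surjective
    ((conjSelmerAc E p κ 𝔭 ∅ γ - 1 : AddMonoid.End (selmerAc E p κ 𝔭 ∅)) :
      selmerAc E p κ 𝔭 ∅ → selmerAc E p κ 𝔭 ∅)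

/-- **(P11) JSW17 Prop. 3.3.4 Case 1(a)/2(a) = Greenberg LNM 1716 pp. 74–75 — PUB shape (local).**
"the kernel of `r_w` is isomorphic to `H¹_ur(K_w, W)/H¹_f(K_w, W)`. But the order of the latter is
exactly the `p`-part `c_w^{(p)}(W)` of the Tamagawa number at `w`" (`w ∤ p` split in `K`, hence
finitely decomposed and unramified in `K_∞^{ac}`): `#ker(H¹(K_w, E[p^∞]) → H¹(K_{∞,η}, E[p^∞])) =
p^{ord_p c_w(E/K)}` for the sibling's `AcSelmer.localKer` and the tree's local Tamagawa number of
`E ⊗ K_w`. A predicate on `(E, p, κ, w)`; nothing asserted; NOT a named fact.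
[cite: JetchevSkinnerWan2017, Prop. 3.3.4 Case 1(a) (arXiv:1512.06894 pp. 12–13) (shape only; nothing asserted)]
[cite: GreenbergLNM1716, §3 pp. 74–75 (shape only; nothing asserted)] -/
def LocalKernelOrderAt (E : WeierstrassCurve K) (p : ℕ) [Fact p.Prime] (κ : ZpExtension K p)
    (v : HeightOneSpectrum (𝓞 K)) : Prop :=
  ∃ _ : Finite (localKer κ.kerSubgroup (E.geomPrimaryTorsion p) v),
    Nat.card (localKer κ.kerSubgroup (E.geomPrimaryTorsion p) v) =
      p ^ padicValNat p ((E.baseChange (v.adicCompletion K)).localTamagawaNumber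
        (v.adicCompletionIntegers K))

end Atoms

/-! ## Tamagawa bookkeeping: `ord_p ∏_{w∣N⁺} c_w = Σ_{w∣p} ord_p c_w + Σ_{w∈Σ(N⁺)} ord_p c_w` -/

section Tamagawa

variable {K : Type} [Field K] [NumberField K]

/-- The rational prime `ℓ_w` below a place `w` of `K` lies in `w`. [folklore] -/
theorem natCast_primesEquiv_under_mem (w : HeightOneSpectrum (𝓞 K)) :
    ((Rat.HeightOneSpectrum.primesEquiv (w.under (𝓞 ℚ)) : ℕ) : 𝓞 K) ∈ w.asIdeal := by
  have hQ : ((Rat.HeightOneSpectrum.primesEquiv (w.under (𝓞 ℚ)) : ℕ) : 𝓞 ℚ) ∈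
      (w.under (𝓞 ℚ)).asIdeal :=
    (natCast_mem_asIdeal_iff_eq_primesEquiv_symm _
      (Rat.HeightOneSpectrum.primesEquiv (w.under (𝓞 ℚ))).2).mpr
      (by rw [Subtype.coe_eta, Equiv.symm_apply_apply])
  rw [HeightOneSpectrum.under_asIdeal, Ideal.under_def, Ideal.mem_comap, map_natCast] at hQ
  exact hQ

/-- In a quadratic field, `ℓ_w` splits iff `w` has `e = f = 1` (fundamental identity, place by
place: `placesOver_trichotomy_of_finrank_eq_two`). [cite: NeukirchANT1999, Ch. I (8.2)] -/
theorem splitsIn_primesEquiv_under_iff (h2 : Module.finrank ℚ K = 2) (w : HeightOneSpectrum (𝓞 K)) :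
    SplitsIn K (Rat.HeightOneSpectrum.primesEquiv (w.under (𝓞 ℚ)) : ℕ) ↔
      w.asIdeal.ramificationIdx (𝓞 ℚ) = 1 ∧ w.asIdeal.inertiaDeg (𝓞 ℚ) = 1 := by
  unfold SplitsIn
  rw [ncard_primesOver_span_eq (K := K) (w.under (𝓞 ℚ))]
  have hw : w ∈ {w' : HeightOneSpectrum (𝓞 K) | w'.under (𝓞 ℚ) = w.under (𝓞 ℚ)} := rfl
  rcases placesOver_trichotomy_of_finrank_eq_two K h2 (w.under (𝓞 ℚ)) with
    ⟨w₁, w₂, hne, hset, hef⟩ | ⟨w₀, hset, he1, hf2⟩ | ⟨w₀, hset, he2, hf1⟩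
  · rw [hset, Set.ncard_pair hne]
    exact ⟨fun _ ↦ hef w rfl, fun _ ↦ rfl⟩
  · rw [hset] at hw ⊢
    rw [Set.mem_singleton_iff] at hw
    subst hw
    rw [Set.ncard_singleton]
    constructor
    · intro h; exact absurd h (by norm_num)
    · rintro ⟨-, hf⟩; rw [hf] at hf2; exact absurd hf2 (by norm_num)
  · rw [hset] at hw ⊢
    rw [Set.mem_singleton_iff] at hw
    subst hw
    rw [Set.ncard_singleton]
    constructor
    · intro h; exact absurd h (by norm_num)
    · rintro ⟨he, -⟩; rw [he] at he2; exact absurd he2 (by norm_num)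

/-- For `w ∤ p` in a quadratic `K`: `w ∣ N⁺` (`IsPlaceOverSplitConductorPrime`) iff `w ∈ Σ(N⁺)`
(`nPlusPlaces`). [cite: Castella2018, §2.1–2.2 (arXiv:1704.06608 p. 5), `N = N⁺N⁻`] -/
theorem isPlaceOverSplitConductorPrime_iff_mem_nPlusPlaces {W : WeierstrassCurve ℚ} {p : ℕ}
    (h2 : Module.finrank ℚ K = 2) {w : HeightOneSpectrum (𝓞 K)} (hpw : ((p : ℕ) : 𝓞 K) ∉ w.asIdeal) :
    IsPlaceOverSplitConductorPrime W K w ↔ w ∈ nPlusPlaces W K p := by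
  rw [IsPlaceOverSplitConductorPrime, splitsIn_primesEquiv_under_iff h2, mem_nPlusPlaces_iff]
  tauto

/-- For `w ∣ p` with `p` split in `K` and `p ∣ N_E`: `w ∣ N⁺`. [cite: Castella2018, §2.1 (arXiv:1704.06608 p. 5), `p ∣ N⁺` for `p = 𝔭𝔭̄` split] -/
theorem isPlaceOverSplitConductorPrime_of_mem {W : WeierstrassCurve ℚ} {p : ℕ} [Fact p.Prime]
    (hsplit : SplitsIn K p) (hpN : p ∣ W.conductorNorm ℤ) {w : HeightOneSpectrum (𝓞 K)}
    (hpw : ((p : ℕ) : 𝓞 K) ∈ w.asIdeal) : IsPlaceOverSplitConductorPrime W K w := by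
  rw [IsPlaceOverSplitConductorPrime, under_eq_ratPlace_of_mem hpw, primesEquiv_ratPlace]
  exact ⟨hsplit, hpN⟩

/-- **`ord_p ∏_{w∣N⁺} c_w(E/K) = ord_p ∏_{w∣p} c_w(E/K) + Σ_{w∈Σ(N⁺)} ord_p c_w(E/K)`** for `[K:ℚ] = 2`,
`p` split in `K`, `p ∣ N_E` (Castella's `N⁺` consists of `p` and the primes below `Σ(N⁺)`).
[cite: Castella2018, §2.1 and Thm. 2.3 (arXiv:1704.06608 p. 5)] -/
theorem padicValNat_tamagawaProductSplit_eq_above_add_sum (W : WeierstrassCurve ℚ) [W.IsElliptic]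
    (p : ℕ) [Fact p.Prime] (h2 : Module.finrank ℚ K = 2) (hsplit : SplitsIn K p)
    (hpN : p ∣ W.conductorNorm ℤ) :
    padicValNat p (tamagawaProductSplit W K) = padicValNat p (tamagawaProductAbove W K p) +
      ∑ v ∈ (nPlusPlaces_finite (W := W) (p := p) h2).toFinset,
        padicValNat p (((W.baseChange K).baseChange (v.adicCompletion K)).localTamagawaNumber
          (v.adicCompletionIntegers K)) := by
  haveI hEK : (W.baseChange K).IsElliptic := by rw [baseChange]; infer_instance
  set cK : HeightOneSpectrum (𝓞 K) → ℕ := fun w =>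
    ((W.baseChange K).baseChange (w.adicCompletion K)).localTamagawaNumber
      (w.adicCompletionIntegers K) with hcK
  set g : HeightOneSpectrum (𝓞 K) → ℕ := fun w =>
    if IsPlaceOverSplitConductorPrime W K w then cK w else 1 with hg
  set a : HeightOneSpectrum (𝓞 K) → ℕ := fun w =>
    if ((p : ℕ) : 𝓞 K) ∈ w.asIdeal then cK w else 1 with ha
  set b : HeightOneSpectrum (𝓞 K) → ℕ := fun w =>
    if w ∈ nPlusPlaces W K p then cK w else 1 with hb
  have hcK0 : ∀ w, cK w ≠ 0 := fun w => (W.baseChange K).localTamagawaNumber_baseChange_ne_zero w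
  have hite0 : ∀ (q : Prop) [Decidable q] (w : HeightOneSpectrum (𝓞 K)),
      (if q then cK w else 1) ≠ 0 := fun q _ w => by
    split_ifs
    · exact hcK0 w
    · exact one_ne_zero
  have hfinK : (Function.mulSupport cK).Finite :=
    (W.baseChange K).mulSupport_localTamagawaNumber_finite_holds
  set SK : Finset (HeightOneSpectrum (𝓞 K)) := hfinK.toFinset with hSK
  have hsub : ∀ (q : HeightOneSpectrum (𝓞 K) → Prop) [DecidablePred q],
      (Function.mulSupport fun w => if q w then cK w else 1) ⊆ ↑SK := fun q _ w hw => by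
    rw [Function.mem_mulSupport] at hw
    refine hfinK.mem_toFinset.mpr (Function.mem_mulSupport.mpr ?_)
    by_cases hq : q w
    · simp only [hq, if_true] at hw; exact hw
    · simp only [hq, if_false] at hw; exact (hw rfl).elim
  -- the three valuations as sums over `SK`
  have hval : ∀ (q : HeightOneSpectrum (𝓞 K) → Prop) [DecidablePred q],
      padicValNat p (∏ᶠ w, if q w then cK w else 1) =
        ∑ w ∈ SK, padicValNat p (if q w then cK w else 1) := fun q _ => by
    rw [finprod_eq_prod_of_mulSupport_subset _ (hsub q)]
    exact padicValNat_finset_prod p SK _ fun w _ => hite0 (q w) w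
  have hg' : padicValNat p (tamagawaProductSplit W K) = ∑ w ∈ SK, padicValNat p (g w) :=
    hval fun w => IsPlaceOverSplitConductorPrime W K w
  have ha' : padicValNat p (tamagawaProductAbove W K p) = ∑ w ∈ SK, padicValNat p (a w) :=
    hval fun w => ((p : ℕ) : 𝓞 K) ∈ w.asIdeal
  have hb' : padicValNat p (∏ᶠ w, b w) = ∑ w ∈ SK, padicValNat p (b w) :=
    hval fun w => w ∈ nPlusPlaces W K p
  -- pointwise: `ord_p g = ord_p a + ord_p b`
  have hpt : ∀ w, padicValNat p (g w) = padicValNat p (a w) + padicValNat p (b w) := fun w => by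
    by_cases hpw : ((p : ℕ) : 𝓞 K) ∈ w.asIdeal
    · have hgw : IsPlaceOverSplitConductorPrime W K w := isPlaceOverSplitConductorPrime_of_mem hsplit hpN hpw
      have hbw : w ∉ nPlusPlaces W K p := fun h => ((mem_nPlusPlaces_iff w).mp h).1 hpw
      simp only [hg, ha, hb, hgw, hpw, hbw, if_true, if_false, padicValNat_one_right, add_zero]
    · by_cases hbw : w ∈ nPlusPlaces W K p
      · have hgw : IsPlaceOverSplitConductorPrime W K w :=
          (isPlaceOverSplitConductorPrime_iff_mem_nPlusPlaces h2 hpw).mpr hbw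
        simp only [hg, ha, hb, hgw, hpw, hbw, if_true, if_false, padicValNat_one_right, zero_add]
      · have hgw : ¬ IsPlaceOverSplitConductorPrime W K w := fun h =>
          hbw ((isPlaceOverSplitConductorPrime_iff_mem_nPlusPlaces h2 hpw).mp h)
        simp only [hg, ha, hb, hgw, hpw, hbw, if_false, padicValNat_one_right, add_zero]
  -- the `b`-product is the sum over `Σ(N⁺)`
  set T : Finset (HeightOneSpectrum (𝓞 K)) := (nPlusPlaces_finite (W := W) (p := p) h2).toFinset
    with hT
  have hbT : (Function.mulSupport b) ⊆ ↑T := fun w hw => by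
    rw [Function.mem_mulSupport] at hw
    refine (nPlusPlaces_finite (W := W) (p := p) h2).mem_toFinset.mpr ?_
    by_contra hbw
    exact hw (by simp only [hb, hbw, if_false])
  have hbprod : (∏ᶠ w, b w) = ∏ w ∈ T, cK w := by
    rw [finprod_eq_prod_of_mulSupport_subset b hbT]
    refine Finset.prod_congr rfl fun w hw => ?_
    have hbw : w ∈ nPlusPlaces W K p := (nPlusPlaces_finite (W := W) (p := p) h2).mem_toFinset.mp hw
    simp only [hb, hbw, if_true]
  have hbsum : padicValNat p (∏ᶠ w, b w) = ∑ w ∈ T, padicValNat p (cK w) := by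
    rw [hbprod]
    exact padicValNat_finset_prod p T cK fun w _ => hcK0 w
  rw [hg', ha', ← hbsum, hb', ← Finset.sum_add_distrib]
  exact Finset.sum_congr rfl fun w _ => hpt w

end Tamagawa

/-! ## The assembly at a datum -/

section Assembly

variable {W : WeierstrassCurve ℚ} [W.IsElliptic] [W.IsGloballyMinimal] {K : Type} [Field K]
  [NumberField K] {p : ℕ} [Fact p.Prime]

/-- **Gen 11's bijection from the A′-hypotheses alone**: on `ErratumHypotheses` (`5 ≤ p`, `p`
multiplicative, `E[p]` irreducible, a non-split multiplicative `q` with `E[p]` ramified, (iv)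
`E(ℚ_p)[p] = 0`), for every imaginary quadratic `K`, anticyclotomic `κ` with topological generator
`γ` and degree-one `𝔭 ∣ p`: `s : Sel_𝔭^{Σ(N⁺)}(K, E[p^∞]) → Sel_𝔭^{Σ(N⁺)}(K_∞, E[p^∞])^γ` is bijective
(injective by `Irr ∧ Ram`; strict place by (iv); away places: Lemma 3.3 / split completely).
[cite: JetchevSkinnerWan2017, §3.3 and Thm. 3.3.1 (shape only)] [cite: GreenbergLNM1716, §3 pp. 85–90] -/
theorem ErratumHypotheses.controlMap_bijective_nPlus (hE : ErratumHypotheses W p)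
    (hK : IsImaginaryQuadratic K) {κ : ZpExtension K p} (hκ : κ.IsAnticyclotomic)
    {γ : absoluteGaloisGroup K} (hγ : κ.IsTopGenerator γ) (𝔭 : HeightOneSpectrum (𝓞 K))
    (h𝔭 : ((p : ℕ) : 𝓞 K) ∈ 𝔭.asIdeal) (he : 𝔭.asIdeal.ramificationIdx (𝓞 ℚ) = 1)
    (hf : 𝔭.asIdeal.inertiaDeg (𝓞 ℚ) = 1) :
    Function.Bijective (controlMap (W.baseChange K) p κ 𝔭 (nPlusPlaces W K p) γ) := by
  haveI : IsTotallyComplex K := hK.2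
  exact IsAnticyclotomic.controlMap_bijective_of_splitBad_subset (W.baseChange K) p κ 𝔭
    (nPlusPlaces W K p) hK.1 hκ hγ
    (resSubgroup_kerSubgroup_injective_of_irr_of_ram W p hE.two_ne hE.2.2.1
      (X11.ram_of_aprimeLocusAt hE.2.2.2) K hK.1 κ)
    (hE.fixedPoints_decomp_inf_kerSubgroup_eq_bot K κ 𝔭 h𝔭 he hf)
    (fun v hpv hbad he1 hf1 ↦ mem_nPlusPlaces_of v hpv
      (primesEquiv_under_dvd_conductorNorm_of_not_hasGoodReductionAt K v hbad) he1 hf1)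

/-- `H¹(Γ, Sel) = Sel/(γ − 1)Sel` is trivial when `γ − 1` is onto. [folklore] -/
theorem natCard_endCoinvariants_eq_one_of_surjective {S : Type*} [AddCommGroup S]
    (ψ : AddMonoid.End S) (h : Function.Surjective ψ) :
    Nat.card (IwasawaDual.EndCoinvariants ψ) = 1 := by
  rw [Nat.card_eq_one_iff_exists]
  refine ⟨0, fun y ↦ ?_⟩
  induction y using QuotientAddGroup.induction_on with
  | H s => exact (IwasawaDual.endCoinvariants_mk_eq_zero_iff ψ s).mpr (h s)

/-- **(CTL) FROM THE ATOMS, at a datum.** On the A′-hypotheses, for `K` imaginary quadratic with `p`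
split, an anticyclotomic `κ` with topological generator `γ`, a degree-one `𝔭 ∣ p`, any `ι`, `P`:
(P6) `BaseSelmerCountAt` ∧ (P9) `LocSurjAt` for `Σ(N⁺)` ∧ (L10) `CoinvariantsTrivialAt` ∧ (P11)
`LocalKernelOrderAt` at every `w ∈ Σ(N⁺)` ⟹ `ControlOnTreeAt p κ 𝔭 γ ι P` (Cas18 Thm. 2.3 on the
constructed objects). Proof: `ord_p f_ac(0) = n` ⟺ `#Sel^γ = p^n·#Sel_γ` (gen 9); `#Sel_γ = 1` (L10);
`#Sel^γ = #Sel_𝔭(K)·∏_{w∈Σ(N⁺)} #ker r_w` (`AnticyclotomicSigmaPassage`, `s^{Σ(N⁺)}` bijective, (P9));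
`= p^{a + Σ ord_p c_w}` ((P6), (P11)); and `a + Σ_{w∈Σ(N⁺)} ord_p c_w` is Castella's exponent by
`padicValNat_tamagawaProductSplit_eq_above_add_sum`. [cite: Castella2018, Thm. 2.3 (arXiv:1704.06608 p. 5)]
[cite: JetchevSkinnerWan2017, Thm. 3.3.1 and §3.3.2–3.3.6 (arXiv:1512.06894 pp. 11–14)] -/
theorem controlOnTreeAt_of_atoms (hE : ErratumHypotheses W p) (hK : IsImaginaryQuadratic K)
    (hsplit : SplitsIn K p) {κ : ZpExtension K p} (hκ : κ.IsAnticyclotomic)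
    (γ : absoluteGaloisGroup K) [hγ : Fact (κ.IsTopGenerator γ)] (𝔭 : HeightOneSpectrum (𝓞 K))
    (h𝔭 : ((p : ℕ) : 𝓞 K) ∈ 𝔭.asIdeal) (he : 𝔭.asIdeal.ramificationIdx (𝓞 ℚ) = 1)
    (hf : 𝔭.asIdeal.inertiaDeg (𝓞 ℚ) = 1) (ι : K →+* ℚ_[p]) (P : (W.baseChange K).toAffine.Point)
    (h6 : BaseSelmerCountAt p 𝔭 ι P)
    (h9 : LocSurjAt (W.baseChange K) p 𝔭 (nPlusPlaces_finite (W := W) (p := p) hK.1))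
    (h10 : CoinvariantsTrivialAt (W.baseChange K) p κ 𝔭 γ)
    (h11 : ∀ v ∈ nPlusPlaces W K p, LocalKernelOrderAt (W.baseChange K) p κ v) :
    ControlOnTreeAt p κ 𝔭 γ ι P := by
  have hp : p.Prime := Fact.out
  rw [controlOnTreeAt_iff_card p κ 𝔭 γ ι P]
  obtain ⟨a, ⟨_, hcardK⟩, ha⟩ := h6
  set hfin := nPlusPlaces_finite (W := W) (p := p) (K := K) hK.1 with hfin_def
  have hpN : p ∣ W.conductorNorm ℤ := dvd_conductorNorm_of_mult hE.2.1
  have hSp : ∀ v ∈ nPlusPlaces W K p, ((p : ℕ) : 𝓞 K) ∉ v.asIdeal :=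
    fun v hv ↦ ((mem_nPlusPlaces_iff v).mp hv).1
  have hbij := hE.controlMap_bijective_nPlus hK hκ hγ.out 𝔭 h𝔭 he hf
  have hloc : localKerPi (W.baseChange K) p κ hfin ≤ (locSel (W.baseChange K) p 𝔭 hfin).range := by
    rw [AddMonoidHom.range_eq_top.mpr h9]
    exact le_top
  have hcard := natCard_endInvariants_empty_eq_mul_prod (hS := hfin) hSp γ hbij hloc
  have hprod : (∏ v ∈ hfin.toFinset,
      Nat.card (localKer κ.kerSubgroup ((W.baseChange K).geomPrimaryTorsion p) v)) =
      p ^ ∑ v ∈ hfin.toFinset, padicValNat p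
        (((W.baseChange K).baseChange (v.adicCompletion K)).localTamagawaNumber
          (v.adicCompletionIntegers K)) := by
    rw [← Finset.prod_pow_eq_pow_sum]
    refine Finset.prod_congr rfl fun v hv => ?_
    obtain ⟨_, hv'⟩ := h11 v (hfin.mem_toFinset.mp hv)
    exact hv'
  have hcoinv := natCard_endCoinvariants_eq_one_of_surjective _ h10
  refine ⟨a + ∑ v ∈ hfin.toFinset, padicValNat p
      (((W.baseChange K).baseChange (v.adicCompletion K)).localTamagawaNumber
        (v.adicCompletionIntegers K)), ⟨?_, ?_⟩, ?_⟩
  · refine Nat.finite_of_card_ne_zero ?_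
    rw [hcard, hcardK, hprod, ← pow_add]
    exact pow_ne_zero _ hp.ne_zero
  · rw [hcard, hcardK, hprod, hcoinv, mul_one, pow_add]
  · rw [Nat.cast_add, ha, padicValNat_tamagawaProductSplit_eq_above_add_sum W p hK.1 hsplit hpN]
    push_cast
    ring

end Assembly

end Summit.BirchSwinnertonDyer.Rank1Residual.X11b

end
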